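import Literature.NumberTheory.LFunctions.WeilMarkovQuadratic
import Literature.NumberTheory.LFunctions.WeilGroundState
import Literature.NumberTheory.LFunctions.WeilGroundStateRealZerosProofs
import Literature.NumberTheory.LFunctions.WeilWindowSuzukiProofs
import Literature.NumberTheory.LFunctions.WeilWindowSuzukiAsymptoticProofs

/-!
# Auxiliary toolkit (part 1) for stub `stub_localizedCut` (line `cut-dont-squeeze`)

Infrastructure for the localised-cut inequality of the crux `WeilWindowFlow.WindowLipschitz`
(item stmt-RiemannHypothesis-1039), over the tree objects `weilIncrement` (`D_t`),
`weilArchDensity` (`ρ`), `weilDirichletEnergy`, `weilPoleForm` of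
`Literature/NumberTheory/LFunctions/WeilMarkovQuadratic.lean`:

* measurability in the jump length: for an a.e.-strongly measurable `f`, `t ↦ D_t(f)`, the
  polarised increments `t ↦ D_t(f, g) = ∫ (f(x+t) − f x) conj (g(x+t) − g x) dx` and the commutator
  integrand `t ↦ ∫ (χ(x+t) − χ x)² ‖u(x+t)‖ ‖u x‖ dx` are a.e.-strongly measurable (joint
  measurability of `(t, x) ↦ f (x + t)` through the measure-preserving shear `(t, x) ↦ (t, t + x)`,
  then `AEStronglyMeasurable.integral_prod_right'`);
* bounded Lipschitz multipliers preserve the finite-energy class: for `m` with values in `[0, 1]`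
  and `|m x − m y| ≤ L|x − y|`, `D_t(m u) ≤ 2 D_t(u) + 2 min(L² t², 1) ‖u‖₂²`, and
  `∫₀^∞ ρ(t) min(L² t², 1) dt < ∞` (`ρ(t) ≤ e^{t/2}/(2t)`), so `t ↦ ρ(t) D_t(m u)` is integrable on
  `(0, ∞)` as soon as `t ↦ ρ(t) D_t(u)` is;
* the polarised bound `|D_t(f, g)| ≤ D_t(f) + D_t(g)` and integrability of `t ↦ ρ(t) D_t(f, g)`.

Everything is folklore `L²` bookkeeping over Mathlib and the tree files `WeilMarkovQuadratic`,
`WeilGroundState`, `WeilGroundStateRealZerosProofs`, `WeilWindowSuzukiProofs`; it serves the proof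
of Bombieri's variational inequality for cut ground states (E. Bombieri, *Remarks on Weil's
quadratic functional in the theory of prime numbers I*, Rend. Mat. Acc. Lincei (9) 11 (2000), §4).
-/

set_option linter.dupNamespace false

noncomputable section

open MeasureTheory Set Filter
open scoped Topology ENNReal NNReal ComplexConjugate ArithmeticFunction.vonMangoldt

namespace Summit.RiemannHypothesis.RiemannHypothesis.Theorems.WeilWindowFlowWindowLipschitz

open Literature.NumberTheory.LFunctions Literature.NumberTheory.LFunctions.ConnesVanSuijlekom

/-! ## Measurability in the jump length -/

/-- Joint a.e.-strong measurability of `(t, x) ↦ f (x + t)` for an a.e.-strongly measurable `f`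
(composition with the measure-preserving shear `(t, x) ↦ (t, t + x)`). -/
theorem stub_localizedCut_aesm_shift {E : Type*} [TopologicalSpace E] {f : ℝ → E}
    (hf : AEStronglyMeasurable f volume) :
    AEStronglyMeasurable (fun p : ℝ × ℝ ↦ f (p.2 + p.1)) ((volume : Measure ℝ).prod volume) := by
  have h := (hf.comp_snd (μ := volume)).comp_measurePreserving
    (measurePreserving_prod_add (volume : Measure ℝ) (volume : Measure ℝ))
  refine h.congr (ae_of_all _ fun p ↦ ?_)
  simp only [Function.comp_apply, add_comm]

/-- For `f` a.e.-strongly measurable, `t ↦ D_t(f) = ∫ ‖f(x+t) − f x‖² dx` is a.e.-strongly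
measurable (`AEStronglyMeasurable.integral_prod_right'`). -/
theorem stub_localizedCut_aesm_weilIncrement {f : ℝ → ℂ} (hf : AEStronglyMeasurable f volume) :
    AEStronglyMeasurable (weilIncrement f) volume := by
  have hF : AEStronglyMeasurable (fun p : ℝ × ℝ ↦ ‖f (p.2 + p.1) - f p.2‖ ^ 2)
      ((volume : Measure ℝ).prod volume) :=
    ((stub_localizedCut_aesm_shift hf).sub hf.comp_snd).norm.pow 2
  exact hF.integral_prod_right'

/-- The polarised increment `t ↦ D_t(f, g) = ∫ (f(x+t) − f x) conj (g(x+t) − g x) dx` is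
a.e.-strongly measurable. -/
theorem stub_localizedCut_aesm_polar {f g : ℝ → ℂ} (hf : AEStronglyMeasurable f volume)
    (hg : AEStronglyMeasurable g volume) :
    AEStronglyMeasurable
      (fun t ↦ ∫ x, (f (x + t) - f x) * conj (g (x + t) - g x)) volume := by
  have hF : AEStronglyMeasurable
      (fun p : ℝ × ℝ ↦ (f (p.2 + p.1) - f p.2) * conj (g (p.2 + p.1) - g p.2))
      ((volume : Measure ℝ).prod volume) :=
    ((stub_localizedCut_aesm_shift hf).sub hf.comp_snd).mul
      (Complex.continuous_conj.comp_aestronglyMeasurable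
        ((stub_localizedCut_aesm_shift hg).sub hg.comp_snd))
  exact hF.integral_prod_right'

/-- The commutator integrand `t ↦ ∫ (χ(x+t) − χ x)² ‖u(x+t)‖ ‖u x‖ dx` is a.e.-strongly measurable
for continuous `χ`. -/
theorem stub_localizedCut_aesm_comm {u : ℝ → ℂ} {χ : ℝ → ℝ} (hu : AEStronglyMeasurable u volume)
    (hχ : Continuous χ) :
    AEStronglyMeasurable
      (fun t ↦ ∫ x, (χ (x + t) - χ x) ^ 2 * (‖u (x + t)‖ * ‖u x‖)) volume := by
  have h1 : AEStronglyMeasurable (fun p : ℝ × ℝ ↦ (χ (p.2 + p.1) - χ p.2) ^ 2)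
      ((volume : Measure ℝ).prod volume) :=
    (Continuous.aestronglyMeasurable (by fun_prop))
  have hF : AEStronglyMeasurable
      (fun p : ℝ × ℝ ↦ (χ (p.2 + p.1) - χ p.2) ^ 2 * (‖u (p.2 + p.1)‖ * ‖u p.2‖))
      ((volume : Measure ℝ).prod volume) :=
    h1.mul ((stub_localizedCut_aesm_shift hu).norm.mul hu.comp_snd.norm)
  exact hF.integral_prod_right'

/-! ## Real parts of integrals -/

/-- `∫ Re f = Re ∫ f` for an integrable complex `f` (`integral_re` in `Complex.re` form). -/
theorem stub_localizedCut_integral_re {f : ℝ → ℂ} {μ : Measure ℝ} (hf : Integrable f μ) :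
    ∫ x, (f x).re ∂μ = (∫ x, f x ∂μ).re := by
  have h := integral_re hf
  simpa only [RCLike.re_to_complex] using h

/-- The real part of an integrable complex function is integrable (`Complex.re` form). -/
theorem stub_localizedCut_integrable_re {f : ℝ → ℂ} {μ : Measure ℝ} (hf : Integrable f μ) :
    Integrable (fun x ↦ (f x).re) μ := by
  simpa only [RCLike.re_to_complex] using hf.re

/-- `Re ∫₀^∞ ρ(t) Z(t) dt = ∫₀^∞ ρ(t) Re Z(t) dt` for an integrable integrand. -/
theorem stub_localizedCut_re_setIntegral {Z : ℝ → ℂ}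
    (h : IntegrableOn (fun t ↦ (weilArchDensity t : ℂ) * Z t) (Ioi 0)) :
    (∫ t in Ioi (0 : ℝ), (weilArchDensity t : ℂ) * Z t).re =
      ∫ t in Ioi (0 : ℝ), weilArchDensity t * (Z t).re := by
  rw [← stub_localizedCut_integral_re h]
  simp only [Complex.re_ofReal_mul]

/-! ## Bounded Lipschitz multipliers: `L²` membership and finite energy -/

/-- `m · u ∈ L²` for `u ∈ L²` and a continuous real multiplier with `|m| ≤ 1`. -/
theorem stub_localizedCut_memLp_mul {u : ℝ → ℂ} {m : ℝ → ℝ} (hu : MemLp u 2) (hmc : Continuous m)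
    (hm : ∀ x, |m x| ≤ 1) : MemLp (fun x ↦ (m x : ℂ) * u x) 2 :=
  MemLp.of_le hu ((Complex.continuous_ofReal.comp hmc).aestronglyMeasurable.mul hu.1)
    (ae_of_all _ fun x ↦ by
      rw [norm_mul, Complex.norm_real, Real.norm_eq_abs]
      exact (mul_le_mul_of_nonneg_right (hm x) (norm_nonneg _)).trans_eq (one_mul _))

/-- Pointwise: `‖pU − qV‖² ≤ 2‖U − V‖² + 2(p − q)²‖V‖²` for real `p, q` with `|p| ≤ 1`
(`pU − qV = p(U − V) + (p − q)V`). -/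
theorem stub_localizedCut_norm_mul_sub_mul_sq_le {p q : ℝ} (U V : ℂ) (hp : |p| ≤ 1) :
    ‖(p : ℂ) * U - (q : ℂ) * V‖ ^ 2 ≤ 2 * ‖U - V‖ ^ 2 + 2 * (p - q) ^ 2 * ‖V‖ ^ 2 := by
  have h1 : (p : ℂ) * U - (q : ℂ) * V = (p : ℂ) * (U - V) + ((p - q : ℝ) : ℂ) * V := by
    push_cast
    ring
  have h2 : ‖(p : ℂ) * U - (q : ℂ) * V‖ ≤ ‖U - V‖ + |p - q| * ‖V‖ := by
    rw [h1]
    refine (norm_add_le _ _).trans (add_le_add ?_ ?_)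
    · rw [norm_mul, Complex.norm_real, Real.norm_eq_abs]
      exact (mul_le_mul_of_nonneg_right hp (norm_nonneg _)).trans_eq (one_mul _)
    · rw [norm_mul, Complex.norm_real, Real.norm_eq_abs]
  have h3 : |p - q| ^ 2 = (p - q) ^ 2 := sq_abs _
  nlinarith [h2, norm_nonneg ((p : ℂ) * U - (q : ℂ) * V), norm_nonneg (U - V), norm_nonneg V,
    abs_nonneg (p - q), sq_nonneg (‖U - V‖ - |p - q| * ‖V‖),
    mul_nonneg (abs_nonneg (p - q)) (norm_nonneg V)]

/-- For `m` with values in `[0, 1]` and `|m x − m y| ≤ L|x − y|`: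
`(m(x+t) − m x)² ≤ min(L² t², 1)`. -/
theorem stub_localizedCut_sq_sub_le_min {m : ℝ → ℝ} {L : ℝ} (hm01 : ∀ x, 0 ≤ m x ∧ m x ≤ 1)
    (hmL : ∀ x y, |m x - m y| ≤ L * |x - y|) (x t : ℝ) :
    (m (x + t) - m x) ^ 2 ≤ min (L ^ 2 * t ^ 2) 1 := by
  refine le_min ?_ ?_
  · have h := hmL (x + t) x
    rw [add_sub_cancel_left] at h
    have h' : |m (x + t) - m x| ^ 2 ≤ (L * |t|) ^ 2 := pow_le_pow_left₀ (abs_nonneg _) h 2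
    rwa [sq_abs, mul_pow, sq_abs] at h'
  · obtain ⟨h0, h1⟩ := hm01 (x + t)
    obtain ⟨h0', h1'⟩ := hm01 x
    nlinarith

/-- **Increments of a product.** For `u ∈ L²` and a real multiplier `m` with values in `[0, 1]` and
`|m x − m y| ≤ L|x − y|`: `D_t(m u) ≤ 2 D_t(u) + 2 min(L² t², 1) ‖u‖₂²`. -/
theorem stub_localizedCut_weilIncrement_mul_le {u : ℝ → ℂ} {m : ℝ → ℝ} {L : ℝ} (hu : MemLp u 2)
    (hm01 : ∀ x, 0 ≤ m x ∧ m x ≤ 1) (hmL : ∀ x y, |m x - m y| ≤ L * |x - y|) (t : ℝ) :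
    weilIncrement (fun x ↦ (m x : ℂ) * u x) t ≤
      2 * weilIncrement u t + 2 * min (L ^ 2 * t ^ 2) 1 * ∫ x, ‖u x‖ ^ 2 := by
  have hpt : ∀ x, ‖(m (x + t) : ℂ) * u (x + t) - (m x : ℂ) * u x‖ ^ 2 ≤
      2 * ‖u (x + t) - u x‖ ^ 2 + 2 * min (L ^ 2 * t ^ 2) 1 * ‖u x‖ ^ 2 := fun x ↦ by
    have h1 := stub_localizedCut_norm_mul_sub_mul_sq_le (u (x + t)) (u x)
      (q := m x) (abs_le.2 ⟨by linarith [(hm01 (x + t)).1], (hm01 (x + t)).2⟩)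
    have h2 := stub_localizedCut_sq_sub_le_min hm01 hmL x t
    nlinarith [h1, h2, sq_nonneg ‖u x‖]
  have hi1 : Integrable fun x ↦ ‖u (x + t) - u x‖ ^ 2 := integrable_weilIncrement_integrand hu t
  have hi2 : Integrable fun x ↦ ‖u x‖ ^ 2 := (memLp_two_iff_integrable_sq_norm hu.1).1 hu
  unfold weilIncrement
  calc ∫ x, ‖(m (x + t) : ℂ) * u (x + t) - (m x : ℂ) * u x‖ ^ 2
      ≤ ∫ x, (2 * ‖u (x + t) - u x‖ ^ 2 + 2 * min (L ^ 2 * t ^ 2) 1 * ‖u x‖ ^ 2) :=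
        integral_mono_of_nonneg (ae_of_all _ fun x ↦ by positivity)
          ((hi1.const_mul 2).add (hi2.const_mul _)) (ae_of_all _ hpt)
    _ = 2 * (∫ x, ‖u (x + t) - u x‖ ^ 2) + 2 * min (L ^ 2 * t ^ 2) 1 * ∫ x, ‖u x‖ ^ 2 := by
        rw [integral_add (hi1.const_mul 2) (hi2.const_mul _), integral_const_mul,
          integral_const_mul]

/-- `∫₀^∞ ρ(t) min(c t², 1) dt < ∞` for `c ≥ 0` (`ρ(t) ≤ e^{t/2}/(2t)` on `(0, 1]`, `ρ` integrable
on `(1, ∞)`). -/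
theorem stub_localizedCut_integrableOn_rho_min {c : ℝ} (hc : 0 ≤ c) :
    IntegrableOn (fun t ↦ weilArchDensity t * min (c * t ^ 2) 1) (Ioi 0) := by
  have hmeas : ∀ μ : Measure ℝ,
      AEStronglyMeasurable (fun t ↦ weilArchDensity t * min (c * t ^ 2) 1) μ := fun μ ↦
    (measurable_weilArchDensity.mul ((measurable_const.mul
      (measurable_id.pow_const 2)).min measurable_const)).aestronglyMeasurable
  have hnn : ∀ t, 0 < t → 0 ≤ weilArchDensity t * min (c * t ^ 2) 1 := fun t ht ↦
    mul_nonneg (weilArchDensity_pos ht).le (le_min (by positivity) zero_le_one)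
  rw [← Ioc_union_Ioi_eq_Ioi zero_le_one]
  refine IntegrableOn.union ?_ ?_
  · have hC : IntegrableOn (fun _ ↦ (c * Real.exp (1 / 2) / 2 : ℝ)) (Ioc (0 : ℝ) 1) :=
      integrableOn_const (measure_Ioc_lt_top).ne
    refine Integrable.mono' hC (hmeas _) ?_
    refine (ae_restrict_iff' measurableSet_Ioc).2 (ae_of_all _ fun t ht ↦ ?_)
    have ht0 : 0 < t := ht.1
    have ht1 : t ≤ 1 := ht.2
    rw [Real.norm_of_nonneg (hnn t ht0)]
    calc weilArchDensity t * min (c * t ^ 2) 1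
        ≤ Real.exp (t / 2) / (2 * t) * (c * t ^ 2) :=
          mul_le_mul (weilArchDensity_le_exp_half_div ht0) (min_le_left _ _)
            (le_min (by positivity) zero_le_one) (by positivity)
      _ = c * t * Real.exp (t / 2) / 2 := by
          field_simp
      _ ≤ c * 1 * Real.exp (1 / 2) / 2 := by
          gcongr
      _ = c * Real.exp (1 / 2) / 2 := by ring
  · refine Integrable.mono' (integrableOn_weilArchDensity_Ioi one_pos) (hmeas _) ?_
    refine (ae_restrict_iff' measurableSet_Ioi).2 (ae_of_all _ fun t (ht : 1 < t) ↦ ?_)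
    have ht0 : 0 < t := one_pos.trans ht
    rw [Real.norm_of_nonneg (hnn t ht0)]
    calc weilArchDensity t * min (c * t ^ 2) 1 ≤ weilArchDensity t * 1 :=
          mul_le_mul_of_nonneg_left (min_le_right _ _) (weilArchDensity_pos ht0).le
      _ = weilArchDensity t := mul_one _

/-- **Bounded Lipschitz multipliers preserve finite energy.** If `t ↦ ρ(t) D_t(u)` is integrable on
`(0, ∞)`, `m` is continuous with values in `[0, 1]` and `|m x − m y| ≤ L |x − y|` (`L ≥ 0`), then
`t ↦ ρ(t) D_t(m u)` is integrable on `(0, ∞)`. -/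
theorem stub_localizedCut_finiteEnergy_mul :
    ∀ {u : ℝ → ℂ} {m : ℝ → ℝ} {L : ℝ}, MemLp u 2 → Continuous m → (∀ x, 0 ≤ m x ∧ m x ≤ 1) →
      0 ≤ L → (∀ x y, |m x - m y| ≤ L * |x - y|) →
      IntegrableOn (fun t ↦ weilArchDensity t * weilIncrement u t) (Ioi 0) →
      IntegrableOn (fun t ↦ weilArchDensity t * weilIncrement (fun x ↦ (m x : ℂ) * u x) t)
        (Ioi 0) := by
  intro u m L hu hmc hm01 hL hmL hfin
  have _ := hL
  have hmu : AEStronglyMeasurable (fun x ↦ (m x : ℂ) * u x) volume :=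
    (Complex.continuous_ofReal.comp hmc).aestronglyMeasurable.mul hu.1
  refine Integrable.mono' ((hfin.const_mul 2).add
    ((stub_localizedCut_integrableOn_rho_min (sq_nonneg L)).const_mul (2 * ∫ x, ‖u x‖ ^ 2)))
    (measurable_weilArchDensity.aestronglyMeasurable.mul
      (stub_localizedCut_aesm_weilIncrement hmu)).restrict ?_
  refine (ae_restrict_iff' measurableSet_Ioi).2 (ae_of_all _ fun t (ht : 0 < t) ↦ ?_)
  rw [Real.norm_of_nonneg (mul_nonneg (weilArchDensity_pos ht).le (weilIncrement_nonneg _ _))]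
  have h := stub_localizedCut_weilIncrement_mul_le hu hm01 hmL t
  calc weilArchDensity t * weilIncrement (fun x ↦ (m x : ℂ) * u x) t
      ≤ weilArchDensity t *
          (2 * weilIncrement u t + 2 * min (L ^ 2 * t ^ 2) 1 * ∫ x, ‖u x‖ ^ 2) :=
        mul_le_mul_of_nonneg_left h (weilArchDensity_pos ht).le
    _ = _ := by
        simp only [Pi.add_apply]
        ring

/-! ## Polarised increments -/

/-- `|D_t(f, g)| ≤ D_t(f) + D_t(g)` (`|F Ḡ| = |F||G| ≤ |F|² + |G|²`). -/
theorem stub_localizedCut_norm_polar_le {f g : ℝ → ℂ} (hf : MemLp f 2) (hg : MemLp g 2) (t : ℝ) :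
    ‖∫ x, (f (x + t) - f x) * conj (g (x + t) - g x)‖ ≤ weilIncrement f t + weilIncrement g t := by
  have hi1 := integrable_weilIncrement_integrand hf t
  have hi2 := integrable_weilIncrement_integrand hg t
  refine (norm_integral_le_integral_norm _).trans ?_
  unfold weilIncrement
  rw [← integral_add hi1 hi2]
  refine integral_mono_of_nonneg (ae_of_all _ fun _ ↦ norm_nonneg _) (hi1.add hi2)
    (ae_of_all _ fun x ↦ ?_)
  simp only [norm_mul, Complex.norm_conj]
  nlinarith [sq_nonneg (‖f (x + t) - f x‖ - ‖g (x + t) - g x‖), norm_nonneg (f (x + t) - f x),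
    norm_nonneg (g (x + t) - g x)]

/-- `t ↦ ρ(t) D_t(f, g)` is integrable on `(0, ∞)` as soon as `f` and `g` have finite energy. -/
theorem stub_localizedCut_integrableOn_polar {f g : ℝ → ℂ} (hf : MemLp f 2) (hg : MemLp g 2)
    (hfe : IntegrableOn (fun t ↦ weilArchDensity t * weilIncrement f t) (Ioi 0))
    (hge : IntegrableOn (fun t ↦ weilArchDensity t * weilIncrement g t) (Ioi 0)) :
    IntegrableOn (fun t ↦ (weilArchDensity t : ℂ) *
      ∫ x, (f (x + t) - f x) * conj (g (x + t) - g x)) (Ioi 0) := by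
  refine Integrable.mono' (hfe.add hge)
    ((Complex.continuous_ofReal.measurable.comp
      measurable_weilArchDensity).aestronglyMeasurable.mul
      (stub_localizedCut_aesm_polar hf.1 hg.1)).restrict ?_
  refine (ae_restrict_iff' measurableSet_Ioi).2 (ae_of_all _ fun t (ht : 0 < t) ↦ ?_)
  rw [norm_mul, Complex.norm_real,
    Real.norm_of_nonneg (weilArchDensity_pos ht).le, Pi.add_apply, ← mul_add]
  exact mul_le_mul_of_nonneg_left (stub_localizedCut_norm_polar_le hf hg t)
    (weilArchDensity_pos ht).le

end Summit.RiemannHypothesis.RiemannHypothesis.Theorems.WeilWindowFlowWindowLipschitz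

end
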